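import Summits.ValiantsHypothesis.ValiantsHypothesis.Theorems.LacunarySymmetroidMatrixDescartesPivotRankOneCriticalWindowsRootCount

/-!
# `MatrixDescartes` census — rank-one `(2,K)₁`: PARALLEL LETTERS BEYOND THE PIVOT — the critical directions solve ONE scalar equation
# (the located reduction of seat memo ROOT-COUNT.md §7, kernel: `θ·((t_R + tₚ) + 2u·t_R) = u·(2tₚ + u·(t_R + tₚ))`, `u = √(R_b/(aWₚ))`)

HONEST FRAMING.  Object-search cell `pub-symmetroid`, seat `val-sym-mdr-p1` (generation 25); helper file `--supports` the crux item
stmt-ValiantsHypothesis-18050 (`Theses.LacunarySymmetroid.MatrixDescartes`, OPEN, on HOLD) with NO closure claim.  A STRUCTURE lemma for the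
sub-family behind this session's SEVEN/NINE objects (`…CriticalWindowsOneSidedSeven/Nine`, perturbations of val-sym-mdr-p2's bare pole-weaving
pencil): the pivot letter `p` (point weight `Wₚ = wₚx^{dₚ}`, position `tₚ`, rate `−a`) and `n` letters beyond it ALL PARALLEL at one position
`t_R > tₚ` (point weights `Wₖ`, rates `bₖ > 0`), nothing else.  At a critical point `(x, T)` of the window profile (the two equations of
`…CriticalWindows` §4) the parallel letters enter only through `R = ∑ Wₖ` and `R_b = ∑ bₖWₖ`:
* `parallel_rms` (from the first equation): `T²(Wₚ + R) = Wₚtₚ² + R t_R²` — the direction is the RMS mean of the two positions;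
* `parallel_linear` (from the second, for `tₚ ≤ T ≤ t_R`): `T(√(aWₚ) + √R_b) = √(aWₚ)tₚ + √(R_b)t_R` — it is ALSO the linear mean with weights
  `√(aWₚ), √(R_b)`;
* **`parallel_eliminant`**: hence, with `θ = R/Wₚ` and `u = √(R_b/(aWₚ))`: **`θ·((t_R + tₚ) + 2u t_R) = u·(2tₚ + u(t_R + tₚ))`**, i.e. `θ = g(u)`,
  `g(u) = u(2c + (1+c)u)/((1+c) + 2u)`, `c = tₚ/t_R` — ONE scalar equation in `x` (both `θ(x) = ∑(wₖ/wₚ)x^{dₖ−dₚ}` and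
  `aβ(x) = ∑ bₖ(wₖ/wₚ)x^{dₖ−dₚ} = xθ′ − aθ` are fewnomials with the SAME exponents), equivalently (memo §7) «slope of the log-sum-exp
  `y(s) = log θ(eˢ)` = an explicit increasing function `ψ` of its height».
* `parallel_sum_E1` / `parallel_sum_E2`: the `Finset` bookkeeping turning the two critical equations over `{p} ∪ (parallel letters)` into the
  displayed two-term forms.
LOCATED (exp/parallel_reduction.py): the number of solutions is EXACTLY `2n − 1` on the bare pencils (`n = 2, 3, 4`) and `1` for random data;
CONJECTURE (parallel per-side law) `≤ 2n − 1` — OPEN; splitting one letter off the common position adds one more (the SEVEN/NINE: `2n`).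
Nothing here bears on `MatrixDescartes` in its window, on `DoorA26` / `DoorA34`, registers / ζ, or `VP ≠ VNP`.

[folklore] Real square roots and `Finset` sums.  No definitions, no named facts.
-/

-- `Summit.ValiantsHypothesis.ValiantsHypothesis.…` repeats a component by the D-0017 layout
-- (single-conjunct summit), which the `dupNamespace` linter flags; the name is mandated.
set_option linter.dupNamespace false

namespace Summit.ValiantsHypothesis.ValiantsHypothesis.Theorems.LacunarySymmetroidMatrixDescartes.Pivot.CriticalWindows.Parallel

open Finset
open scoped BigOperators

/-! ## 1. `Finset` bookkeeping: parallel letters enter through `R = ∑ Wₖ` and `R_b = ∑ bₖWₖ` -/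

/-- First critical equation with all non-pivot letters at ONE position `t_R`:
`Wₚ(T² − tₚ²) + ∑ₖ Wₖ(T² − t_R²) = Wₚ(T² − tₚ²) + (∑ₖ Wₖ)(T² − t_R²)`. [bookkeeping] -/
theorem parallel_sum_E1 {ι : Type*} (s : Finset ι) (W : ι → ℝ) (Wp tp tR T : ℝ) :
    Wp * (T ^ 2 - tp ^ 2) + ∑ k ∈ s, W k * (T ^ 2 - tR ^ 2) = Wp * (T ^ 2 - tp ^ 2) + (∑ k ∈ s, W k) * (T ^ 2 - tR ^ 2) := by
  rw [Finset.sum_mul]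

/-- Second critical equation with all non-pivot letters at ONE position `t_R`:
`−aWₚ(T − tₚ)² + ∑ₖ bₖWₖ(T − t_R)² = −aWₚ(T − tₚ)² + (∑ₖ bₖWₖ)(T − t_R)²`. [bookkeeping] -/
theorem parallel_sum_E2 {ι : Type*} (s : Finset ι) (b W : ι → ℝ) (a Wp tp tR T : ℝ) :
    -a * Wp * (T - tp) ^ 2 + ∑ k ∈ s, b k * W k * (T - tR) ^ 2 = -a * Wp * (T - tp) ^ 2 + (∑ k ∈ s, b k * W k) * (T - tR) ^ 2 := by
  rw [Finset.sum_mul]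

/-! ## 2. The two means and the eliminant -/

/-- **RMS MEAN.**  From the first equation: `T²(Wₚ + R) = Wₚtₚ² + R·t_R²`. [folklore] -/
theorem parallel_rms {Wp R tp tR T : ℝ} (h1 : Wp * (T ^ 2 - tp ^ 2) + R * (T ^ 2 - tR ^ 2) = 0) :
    T ^ 2 * (Wp + R) = Wp * tp ^ 2 + R * tR ^ 2 := by
  linarith

/-- **LINEAR MEAN.**  From the second equation with `a, Wₚ > 0`, `R_b ≥ 0` and `tₚ ≤ T ≤ t_R`:
`T(√(aWₚ) + √R_b) = √(aWₚ)tₚ + √(R_b)t_R` (both sides of `aWₚ(T − tₚ)² = R_b(t_R − T)²` are squares of non-negative reals). [folklore] -/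
theorem parallel_linear {a Wp Rb tp tR T : ℝ} (ha : 0 < a) (hWp : 0 < Wp) (hRb : 0 ≤ Rb) (hpT : tp ≤ T) (hTR : T ≤ tR)
    (h2 : -a * Wp * (T - tp) ^ 2 + Rb * (T - tR) ^ 2 = 0) :
    T * (Real.sqrt (a * Wp) + Real.sqrt Rb) = Real.sqrt (a * Wp) * tp + Real.sqrt Rb * tR := by
  have haW : 0 ≤ a * Wp := (mul_pos ha hWp).le
  have hsq : (Real.sqrt (a * Wp) * (T - tp)) ^ 2 = (Real.sqrt Rb * (tR - T)) ^ 2 := by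
    rw [mul_pow, mul_pow, Real.sq_sqrt haW, Real.sq_sqrt hRb]
    nlinarith [h2]
  have h1 : 0 ≤ Real.sqrt (a * Wp) * (T - tp) := mul_nonneg (Real.sqrt_nonneg _) (by linarith)
  have h2' : 0 ≤ Real.sqrt Rb * (tR - T) := mul_nonneg (Real.sqrt_nonneg _) (by linarith)
  have heq : Real.sqrt (a * Wp) * (T - tp) = Real.sqrt Rb * (tR - T) := by
    have := (sq_eq_sq₀ h1 h2').1 hsq
    exact this
  linarith [heq]

/-- **THE ELIMINANT.**  With `θ = R/Wₚ`, `u = √R_b/√(aWₚ)` (`= √(R_b/(aWₚ))`), the two means force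
`θ·((t_R + tₚ) + 2u·t_R) = u·(2tₚ + u·(t_R + tₚ))` (for `tₚ ≠ t_R`): substitute `T(1 + u) = tₚ + u·t_R` into the RMS identity, expand, cancel the
factor `t_R − tₚ`. [this file] -/
theorem parallel_eliminant {a Wp R Rb tp tR T : ℝ} (ha : 0 < a) (hWp : 0 < Wp) (hRb : 0 ≤ Rb) (hpR : tp < tR) (hpT : tp ≤ T) (hTR : T ≤ tR)
    (h1 : Wp * (T ^ 2 - tp ^ 2) + R * (T ^ 2 - tR ^ 2) = 0) (h2 : -a * Wp * (T - tp) ^ 2 + Rb * (T - tR) ^ 2 = 0) :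
    (R / Wp) * ((tR + tp) + 2 * (Real.sqrt Rb / Real.sqrt (a * Wp)) * tR)
      = (Real.sqrt Rb / Real.sqrt (a * Wp)) * (2 * tp + (Real.sqrt Rb / Real.sqrt (a * Wp)) * (tR + tp)) := by
  have haW : 0 < a * Wp := mul_pos ha hWp
  have hσ : 0 < Real.sqrt (a * Wp) := Real.sqrt_pos.2 haW
  set σ := Real.sqrt (a * Wp) with hσdef
  set ρ := Real.sqrt Rb with hρdef
  have hlin := parallel_linear ha hWp hRb hpT hTR h2
  have hrms := parallel_rms h1
  -- u = ρ/σ; T(σ + ρ) = σ tp + ρ tR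
  set u := ρ / σ with hu
  have hT : T * (1 + u) = tp + u * tR := by
    rw [hu]; field_simp; linarith [hlin]
  -- (tp + u tR)² (Wp + R) = (1+u)² (Wp tp² + R tR²)
  have hkey : (tp + u * tR) ^ 2 * (Wp + R) = (1 + u) ^ 2 * (Wp * tp ^ 2 + R * tR ^ 2) := by
    have : (T * (1 + u)) ^ 2 * (Wp + R) = (1 + u) ^ 2 * (T ^ 2 * (Wp + R)) := by ring
    rw [← hT, this, hrms]
  -- expand and cancel (tR − tp)
  have hexp : (tR - tp) * (R * ((tR + tp) + 2 * u * tR) - Wp * (u * (2 * tp + u * (tR + tp)))) = 0 := by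
    nlinarith [hkey]
  have hne : tR - tp ≠ 0 := sub_ne_zero.2 (ne_of_gt hpR)
  have hzero : R * ((tR + tp) + 2 * u * tR) - Wp * (u * (2 * tp + u * (tR + tp))) = 0 := by
    rcases mul_eq_zero.1 hexp with h | h
    · exact absurd h hne
    · exact h
  rw [div_mul_eq_mul_div, div_eq_iff hWp.ne']
  linarith [hzero]

/-- **PACKAGED FORM** (the `Finset` currency of `…CriticalWindowsLone*`, rates `βₘ = dₘ − e`): pivot `p` at `tₚ`, all other letters at the common
position `t_R > tₚ`; at a critical point `(x, T)` with `tₚ ≤ T ≤ t_R` the eliminant holds with `Wₚ = wₚx^{dₚ}`, `R = ∑_{k≠p} wₖx^{dₖ}`,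
`R_b = ∑_{k≠p}(dₖ − e)wₖx^{dₖ}`, `a = e − dₚ`. [this file] -/
theorem parallel_eliminant_of_critical {ι : Type*} [DecidableEq ι] (s : Finset ι) (w : ι → ℝ) (d : ι → ℕ) (e : ℕ) (p : ι) (tp tR : ℝ)
    (hp : p ∈ s) (hw : ∀ m ∈ s, 0 < w m) (hdp : d p < e) (hdm : ∀ m ∈ s, m ≠ p → e < d m) (hpR : tp < tR)
    {x T : ℝ} (hx : 0 < x) (hpT : tp ≤ T) (hTR : T ≤ tR)
    (c₁ : w p * x ^ d p * (T ^ 2 - tp ^ 2) + ∑ m ∈ s.erase p, w m * x ^ d m * (T ^ 2 - tR ^ 2) = 0)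
    (c₂ : ((d p : ℝ) - e) * (w p * x ^ d p) * (T - tp) ^ 2 + ∑ m ∈ s.erase p, ((d m : ℝ) - e) * (w m * x ^ d m) * (T - tR) ^ 2 = 0) :
    ((∑ m ∈ s.erase p, w m * x ^ d m) / (w p * x ^ d p))
        * ((tR + tp) + 2 * (Real.sqrt (∑ m ∈ s.erase p, ((d m : ℝ) - e) * (w m * x ^ d m))
            / Real.sqrt (((e : ℝ) - d p) * (w p * x ^ d p))) * tR)
      = (Real.sqrt (∑ m ∈ s.erase p, ((d m : ℝ) - e) * (w m * x ^ d m)) / Real.sqrt (((e : ℝ) - d p) * (w p * x ^ d p)))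
        * (2 * tp + (Real.sqrt (∑ m ∈ s.erase p, ((d m : ℝ) - e) * (w m * x ^ d m))
            / Real.sqrt (((e : ℝ) - d p) * (w p * x ^ d p))) * (tR + tp)) := by
  have hWp : 0 < w p * x ^ d p := mul_pos (hw p hp) (pow_pos hx _)
  have ha : (0 : ℝ) < (e : ℝ) - d p := by
    have : (d p : ℝ) < e := by exact_mod_cast hdp
    linarith
  have hRb : 0 ≤ ∑ m ∈ s.erase p, ((d m : ℝ) - e) * (w m * x ^ d m) := by
    refine Finset.sum_nonneg fun m hm => ?_
    have hmp : m ≠ p := Finset.ne_of_mem_erase hm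
    have hms : m ∈ s := Finset.mem_of_mem_erase hm
    have : (e : ℝ) < d m := by exact_mod_cast hdm m hms hmp
    exact mul_nonneg (by linarith) (mul_pos (hw m hms) (pow_pos hx _)).le
  have h1 : w p * x ^ d p * (T ^ 2 - tp ^ 2) + (∑ m ∈ s.erase p, w m * x ^ d m) * (T ^ 2 - tR ^ 2) = 0 := by
    rw [Finset.sum_mul]; exact c₁
  have h2 : -((e : ℝ) - d p) * (w p * x ^ d p) * (T - tp) ^ 2
      + (∑ m ∈ s.erase p, ((d m : ℝ) - e) * (w m * x ^ d m)) * (T - tR) ^ 2 = 0 := by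
    rw [Finset.sum_mul]
    have : -((e : ℝ) - d p) * (w p * x ^ d p) * (T - tp) ^ 2 = ((d p : ℝ) - e) * (w p * x ^ d p) * (T - tp) ^ 2 := by ring
    rw [this]; exact c₂
  exact parallel_eliminant ha hWp hRb hpR hpT hTR h1 h2

end Summit.ValiantsHypothesis.ValiantsHypothesis.Theorems.LacunarySymmetroidMatrixDescartes.Pivot.CriticalWindows.Parallel
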